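import Summits.QuantumFields.YangMills.Theorems.ToronValleyVolumeLojasiewiczLocaliseQuaternion
import HarnessLib

/-!
# Near-commuting unit quaternions with ONE member far from `±1` are LINEARLY near a commuting family

Pure quaternion algebra for the deciding crux `VirialFluxGap.PeriodicSoftness` (item stmt-QuantumFields-24141): the algebraic input of the
REGULAR-VALLEY coercivity (quadratic growth of the periodic ring deficit transverse to the toron valley AWAY from the sixteen central torons),
which both Euler-field routes to ⟨24141⟩ (IBP: LEAD g92 ∕ w3 g58; volume scaling: ✓`VolumeScaling.periodicSoftness_of_scaling`) need in
order to absorb cubic Taylor remainders.  Compare ✓`Lojasiewicz.exists_commuting_near_of_norm_comm_le` (fcl-p3 g33, crux ⟨24498⟩): WITHOUT a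
regular member the best exponent is `½` (the commutator cone); WITH one it is `1`:

* ★ `exists_commuting_near_of_norm_comm_le_of_far` — if `‖q i‖ = 1` for all `i`, `‖q i * q j − q j * q i‖ ≤ η` for all `i, j`, and ONE member
  `q i₀` has `|Im q i₀|² ≥ ρ² > 0`, then there is a pairwise-commuting family `y` of unit quaternions with `‖q i − y i‖ ≤ η/ρ` for every `i`
  (project every imaginary part on the axis of `q i₀` and re-normalise the real part: the removed perpendicular component has
  `|w_i|² = (|Im q_i|²|Im q_{i₀}|² − (Im q_i·Im q_{i₀})²)/|Im q_{i₀}|² = ‖[q_i, q_{i₀}]‖²/(4|Im q_{i₀}|²) ≤ η²/(4ρ²)`, and `‖q_i − y_i‖² ≤ 2|w_i|²`).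

HONEST FRAMING: elementary algebra in `ℍ`; nothing about the lattice, the deficit or Yang–Mills is proved here; ⟨24141⟩ stays OPEN; the
Yang–Mills mass gap is NOT proved.  THEOREMS ONLY: no definition, no `sorry`.  Width seat `ym-line-sfw-p2-w2` g51 (cell ym-idea-1, free hands),
`--supports stmt-QuantumFields-24141`.
-/

set_option autoImplicit false

noncomputable section

open scoped Quaternion

namespace Summit.QuantumFields.YangMills.Theorems.VirialFluxGap.RegularValley

open Summit.QuantumFields.YangMills.Theorems.ToronValleyVolume.Lojasiewicz

/-- ★ **Near-commuting unit quaternions with a REGULAR member are linearly near a commuting family.**  If `‖q i‖ = 1` for all `i`,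
`‖q i * q j − q j * q i‖ ≤ η` for all `i, j`, and `|Im (q i₀)|² ≥ ρ²` with `ρ > 0`, then there is a pairwise-commuting family `y` of unit
quaternions with `‖q i − y i‖ ≤ η / ρ` for every `i` (Łojasiewicz exponent ONE away from the centre `±1`). [folklore] -/
theorem exists_commuting_near_of_norm_comm_le_of_far {ι : Type*} (q : ι → ℍ) {η ρ : ℝ} (hη : 0 ≤ η) (hρ : 0 < ρ) (h1 : ∀ i, ‖q i‖ = 1)
    (hc : ∀ i j, ‖q i * q j - q j * q i‖ ≤ η) (i₀ : ι)
    (hfar : ρ ^ 2 ≤ ((q i₀).imI * (q i₀).imI + (q i₀).imJ * (q i₀).imJ + (q i₀).imK * (q i₀).imK)) :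
    ∃ y : ι → ℍ, (∀ i, ‖y i‖ = 1) ∧ (∀ i j, y i * y j = y j * y i) ∧ ∀ i, ‖q i - y i‖ ≤ η / ρ := by
  -- `re² + |Im|² = 1`
  have hunit : ∀ i, (q i).re ^ 2 + ((q i).imI * (q i).imI + (q i).imJ * (q i).imJ + (q i).imK * (q i).imK) = 1 := fun i => by
    rw [← norm_sq_eq_re_sq_add_imDot, h1 i, one_pow]
  -- to bound `‖q i − y i‖` by `η/ρ` it suffices to bound the square by `(η/ρ)²`
  have hηρ : 0 ≤ η / ρ := div_nonneg hη hρ.le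
  have key : ∀ (i : ι) (y : ℍ), ‖q i - y‖ ^ 2 ≤ (η / ρ) ^ 2 → ‖q i - y‖ ≤ η / ρ := fun i y h =>
    (pow_le_pow_iff_left₀ (norm_nonneg _) hηρ two_ne_zero).1 h
  have unit_of_sq : ∀ y : ℍ, ‖y‖ ^ 2 = 1 → ‖y‖ = 1 := fun y h => by
    have h0 : 0 ≤ ‖y‖ := norm_nonneg _
    nlinarith [h]
  -- the pivot `u = q i₀`, its imaginary mass `m ≥ ρ² > 0`
  set u : ℍ := q i₀ with hu
  set m : ℝ := (u.imI * u.imI + u.imJ * u.imJ + u.imK * u.imK) with hm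
  have hρ2 : 0 < ρ ^ 2 := by positivity
  have hmpos : 0 < m := lt_of_lt_of_le hρ2 hfar
  have hm0 : 0 ≤ m := hmpos.le
  -- unit axis `n = Im u / √m`, projection coefficient `t i = (Im q i · Im u)/√m`
  set r : ℝ := Real.sqrt m with hr
  have hrpos : 0 < r := Real.sqrt_pos.2 hmpos
  have hr2 : r ^ 2 = m := Real.sq_sqrt hm0
  set n₁ : ℝ := u.imI / r with hn₁
  set n₂ : ℝ := u.imJ / r with hn₂
  set n₃ : ℝ := u.imK / r with hn₃
  have hn : n₁ ^ 2 + n₂ ^ 2 + n₃ ^ 2 = 1 := by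
    rw [hn₁, hn₂, hn₃, div_pow, div_pow, div_pow, ← add_div, ← add_div, ← imDot_self_eq, ← hm, hr2]
    exact div_self hmpos.ne'
  set t : ι → ℝ := fun i => ((q i).imI * u.imI + (q i).imJ * u.imJ + (q i).imK * u.imK) / r with ht
  have hdot : ∀ i, (q i).imI * n₁ + (q i).imJ * n₂ + (q i).imK * n₃ = t i := fun i => by
    rw [ht, hn₁, hn₂, hn₃]; dsimp only; field_simp
  -- the removed (perpendicular) part: `|w i|² = |Im q i|² − t i² = ‖[q i, u]‖²/(4m) ∈ [0, η²/(4ρ²)]`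
  have hW_eq : ∀ i, ((q i).imI * (q i).imI + (q i).imJ * (q i).imJ + (q i).imK * (q i).imK) - t i ^ 2 =
      (((q i).imI * (q i).imI + (q i).imJ * (q i).imJ + (q i).imK * (q i).imK) * m -
        ((q i).imI * u.imI + (q i).imJ * u.imJ + (q i).imK * u.imK) ^ 2) / m := fun i => by
    rw [ht]; dsimp only; rw [div_pow, hr2]; field_simp
  have hX0 : ∀ i, 0 ≤ ((q i).imI * (q i).imI + (q i).imJ * (q i).imJ + (q i).imK * (q i).imK) * m -
      ((q i).imI * u.imI + (q i).imJ * u.imJ + (q i).imK * u.imK) ^ 2 := by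
    intro i
    have := normSq_comm_eq (q i) u
    have h0 : 0 ≤ ‖q i * u - u * q i‖ ^ 2 := sq_nonneg _
    rw [hm]; linarith
  have hwnn : ∀ i, 0 ≤ ((q i).imI * (q i).imI + (q i).imJ * (q i).imJ + (q i).imK * (q i).imK) - t i ^ 2 := by
    intro i
    rw [hW_eq]; exact div_nonneg (hX0 i) hm0
  have hw : ∀ i, ((q i).imI * (q i).imI + (q i).imJ * (q i).imJ + (q i).imK * (q i).imK) - t i ^ 2 ≤ η ^ 2 / (4 * ρ ^ 2) := by
    intro i
    have hsq : ‖q i * u - u * q i‖ ^ 2 ≤ η ^ 2 := by rw [hu]; exact pow_le_pow_left₀ (norm_nonneg _) (hc i i₀) 2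
    rw [normSq_comm_eq, ← hm] at hsq
    rw [hW_eq, div_le_div_iff₀ hmpos (by positivity)]
    -- `(|Im q|² m − dot²)·4ρ² ≤ (|Im q|² m − dot²)·4m ≤ η²·m`
    have h4 := mul_le_mul_of_nonneg_left hfar (hX0 i)
    nlinarith [h4, hsq, hX0 i, hm0]
  -- the witness
  let y : ι → ℍ := fun i => ⟨(if 0 ≤ (q i).re then (1:ℝ) else -1) *
    Real.sqrt ((q i).re ^ 2 + (((q i).imI * (q i).imI + (q i).imJ * (q i).imJ + (q i).imK * (q i).imK) - t i ^ 2)), t i * n₁, t i * n₂, t i * n₃⟩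
  have hy_re : ∀ i, (y i).re = (if 0 ≤ (q i).re then (1:ℝ) else -1) *
      Real.sqrt ((q i).re ^ 2 + (((q i).imI * (q i).imI + (q i).imJ * (q i).imJ + (q i).imK * (q i).imK) - t i ^ 2)) := fun i => rfl
  have hy_I : ∀ i, (y i).imI = t i * n₁ := fun i => rfl
  have hy_J : ∀ i, (y i).imJ = t i * n₂ := fun i => rfl
  have hy_K : ∀ i, (y i).imK = t i * n₃ := fun i => rfl
  refine ⟨y, fun i => unit_of_sq _ ?_, fun i j => ?_, fun i => key i (y i) ?_⟩
  · -- unit norm: `(re² + |w|²) + t² (n·n) = re² + |Im|² = 1`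
    rw [norm_sq_eq_re_sq_add_imDot, imDot_self_eq, hy_re, hy_I, hy_J, hy_K, mul_pow, signRe_sq, one_mul,
      Real.sq_sqrt (by have := hwnn i; positivity)]
    linear_combination hunit i + t i ^ 2 * hn
  · exact mul_comm_of_im_parallel n₁ n₂ n₃ _ _ _ _
  · -- distance: `(re − re')² + |w|² ≤ 2|w|² ≤ η²/(2ρ²) ≤ (η/ρ)²`
    have hwnn_i := hwnn i
    set W : ℝ := ((q i).imI * (q i).imI + (q i).imJ * (q i).imJ + (q i).imK * (q i).imK) - t i ^ 2 with hW
    have hre : ((q i).re - (if 0 ≤ (q i).re then (1:ℝ) else -1) * Real.sqrt ((q i).re ^ 2 + W)) ^ 2 ≤ W := by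
      have e1 : (q i).re - (if 0 ≤ (q i).re then (1:ℝ) else -1) * Real.sqrt ((q i).re ^ 2 + W) =
          (if 0 ≤ (q i).re then (1:ℝ) else -1) * (|(q i).re| - Real.sqrt ((q i).re ^ 2 + W)) := by
        rw [mul_sub, signRe_mul_abs_re]
      rw [e1, mul_pow, signRe_sq, one_mul]
      have h2 := sqrt_sq_add_sub_abs_le (x := (q i).re) hwnn_i
      have h3 : |(q i).re| ≤ Real.sqrt ((q i).re ^ 2 + W) := by
        rw [← Real.sqrt_sq_eq_abs]; exact Real.sqrt_le_sqrt (by linarith)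
      have h4 : 0 ≤ Real.sqrt ((q i).re ^ 2 + W) - |(q i).re| := by linarith
      calc (|(q i).re| - Real.sqrt ((q i).re ^ 2 + W)) ^ 2 = (Real.sqrt ((q i).re ^ 2 + W) - |(q i).re|) ^ 2 := by ring
        _ ≤ Real.sqrt W ^ 2 := pow_le_pow_left₀ h4 h2 2
        _ = W := Real.sq_sqrt hwnn_i
    have him : ((q i).imI - t i * n₁) ^ 2 + ((q i).imJ - t i * n₂) ^ 2 + ((q i).imK - t i * n₃) ^ 2 = W := by
      have hv : (q i).imI ^ 2 + (q i).imJ ^ 2 + (q i).imK ^ 2 = ((q i).imI * (q i).imI + (q i).imJ * (q i).imJ + (q i).imK * (q i).imK) :=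
        (imDot_self_eq _).symm
      rw [hW]
      linear_combination hv - 2 * t i * hdot i + t i ^ 2 * hn
    rw [norm_sq_eq_re_sq_add_imDot, imDot_self_eq, Quaternion.re_sub, Quaternion.imI_sub, Quaternion.imJ_sub, Quaternion.imK_sub,
      hy_re, hy_I, hy_J, hy_K, ← hW]
    have hWb : W ≤ η ^ 2 / (4 * ρ ^ 2) := hw i
    have e : (η / ρ) ^ 2 = 4 * (η ^ 2 / (4 * ρ ^ 2)) := by field_simp
    rw [e]
    linarith [hre, him]

end Summit.QuantumFields.YangMills.Theorems.VirialFluxGap.RegularValley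

end
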